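import Literature.NumberTheory.LFunctions.KMVLogCutoffWBound
import Mathlib.Analysis.PSeries
import HarnessLib

/-!
# Route `PrimeLevelFamEdge`, crux K_A `MomentsBeyondDiagonal` (stmt-Parity-20007), line «petersson_layers» v4,
# registered stub `stub_diag : SubDiag` — THE BOX TAIL OF ONE DIAGONAL LINE IS `≪_A (y(T+1)²)^{−A}(T+1)^{i+j+1}` (Rankin)

After `…DiagLineSeries` (p811381) the diagonal part is the explicit line series minus, per line, the tail
`Σ'_{l ≥ 0} g(l+1+T⋆)`, `g(t) = t⁻¹ 𝒲_{ij}(A₁ − log t, A₂ − log t; y t²)` (`𝒲_{ij} = KMV2000.logCutoffW i j`). This file bounds that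
tail for ONE line from the tree's Rankin bound `KMV2000.abs_logCutoffW_le`
(`|𝒲_{ij}(a₁,a₂;Y)| ≤ C_A(i)C_A(j) Y^{−A}(1+|a₁|)^i(1+|a₂|)^j`) and `1 + |A − log t| ≤ (1+|A|)·t` (`t ≥ 1`):

* `abs_lineTail_term_le` — `|g(t)| ≤ C_A(i)C_A(j)(1+|A₁|)^i(1+|A₂|)^j · y^{−A} · t^{i+j−1−2A}` (`t ≥ 1`, `y > 0`);
* `abs_tsum_lineTail_le` — for `2A ≥ i+j+1`:
  `|Σ'_{l≥0} g(l+1+T)| ≤ C_A(i)C_A(j)(1+|A₁|)^i(1+|A₂|)^j · (Σ'_{n≥0}(n+1)⁻²) · y^{−A} (T+1)^{i+j+1−2A}`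
  (`= … (y(T+1)²)^{−A}(T+1)^{i+j+1}`; in the application `y(T⋆+1)² ≥ q⁴/(q̂²M³) ≥ q^{3/4}` on `Δ' ≤ 3/2`, so every `A` buys `q^{−3A/4}`).

Remaining for the box tail of `diagPart` (census R1): sum this over `(i,j,m₁,m₂,d₁,d₂)` with `|x_m| ≤ B_P m^{−1/2}`, `c ≤ M`,
`1+|A_ν| ≤ 1 + 3 log q`, `T⋆ + 1 ≤ q² + 1`. Helper `--supports stmt-Parity-20007`; closes nothing; K_A, K_B and the Parity summit are
NOT proved; nothing about Landau–Siegel zeros.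
-/

noncomputable section

open scoped Real
open Complex Finset MeasureTheory Set
open Literature.NumberTheory.LFunctions

namespace Summit.Parity.GeneralizedHardyLittlewood.Theorems.MomentsBeyondDiagonal.DiagLines

/-- `1 + |A − log t| ≤ (1 + |A|) · t` for `t ≥ 1` (`0 ≤ log t ≤ t − 1`). [folklore] -/
theorem one_add_abs_sub_log_le {A t : ℝ} (ht : 1 ≤ t) : 1 + |A - Real.log t| ≤ (1 + |A|) * t := by
  have hlog0 : 0 ≤ Real.log t := Real.log_nonneg ht
  have hlog1 : Real.log t ≤ t - 1 := Real.log_le_sub_one_of_pos (by linarith)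
  have h1 : |A - Real.log t| ≤ |A| + Real.log t := by
    calc |A - Real.log t| ≤ |A| + |Real.log t| := abs_sub _ _
      _ = |A| + Real.log t := by rw [abs_of_nonneg hlog0]
  nlinarith [abs_nonneg A]

/-- **One term of the line tail** (`t ≥ 1`, `y > 0`, `A ≥ 0`):
`|t⁻¹ 𝒲_{ij}(A₁ − log t, A₂ − log t; y t²)| ≤ C_A(i)C_A(j)(1+|A₁|)^i(1+|A₂|)^j · y^{−A} · t^{i+j−1−2A}`.
[cite: KowalskiMichelVanderKam2000, (22) p. 12 — derivation (Rankin on the real form)] -/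
theorem abs_lineTail_term_le (i j : ℕ) {A : ℝ} (hA : 0 ≤ A) (A₁ A₂ : ℝ) {y : ℝ} (hy : 0 < y) {t : ℝ} (ht : 1 ≤ t) :
    |t⁻¹ * KMV2000.logCutoffW i j (A₁ - Real.log t) (A₂ - Real.log t) (y * t ^ 2)| ≤
      ((∫ x in Ioi (0 : ℝ), x ^ A * (Real.exp (-x) * (2 ^ i * (1 + |Real.log x| ^ i)))) *
        ∫ x in Ioi (0 : ℝ), x ^ A * (Real.exp (-x) * (2 ^ j * (1 + |Real.log x| ^ j)))) *
      (1 + |A₁|) ^ i * (1 + |A₂|) ^ j * y ^ (-A) * t ^ ((i + j : ℝ) - 1 - 2 * A) := by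
  set C : ℝ := (∫ x in Ioi (0 : ℝ), x ^ A * (Real.exp (-x) * (2 ^ i * (1 + |Real.log x| ^ i)))) *
    ∫ x in Ioi (0 : ℝ), x ^ A * (Real.exp (-x) * (2 ^ j * (1 + |Real.log x| ^ j))) with hC
  have hC0 : 0 ≤ C := by
    have h1 : 0 ≤ ∫ x in Ioi (0 : ℝ), x ^ A * (Real.exp (-x) * (2 ^ i * (1 + |Real.log x| ^ i))) :=
      setIntegral_nonneg measurableSet_Ioi fun x hx ↦ by have hx : (0 : ℝ) < x := hx; positivity
    have h2 : 0 ≤ ∫ x in Ioi (0 : ℝ), x ^ A * (Real.exp (-x) * (2 ^ j * (1 + |Real.log x| ^ j))) :=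
      setIntegral_nonneg measurableSet_Ioi fun x hx ↦ by have hx : (0 : ℝ) < x := hx; positivity
    exact mul_nonneg h1 h2
  have ht0 : 0 < t := by linarith
  have hyt : 0 < y * t ^ 2 := by positivity
  have hW := KMV2000.abs_logCutoffW_le i j hA (A₁ - Real.log t) (A₂ - Real.log t) hyt
  have hl₁ := one_add_abs_sub_log_le (A := A₁) ht
  have hl₂ := one_add_abs_sub_log_le (A := A₂) ht
  have h0₁ : 0 ≤ 1 + |A₁ - Real.log t| := by positivity
  have h0₂ : 0 ≤ 1 + |A₂ - Real.log t| := by positivity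
  have hp₁ : (1 + |A₁ - Real.log t|) ^ i ≤ (1 + |A₁|) ^ i * t ^ (i : ℝ) := by
    rw [Real.rpow_natCast, ← mul_pow]; exact pow_le_pow_left₀ h0₁ hl₁ i
  have hp₂ : (1 + |A₂ - Real.log t|) ^ j ≤ (1 + |A₂|) ^ j * t ^ (j : ℝ) := by
    rw [Real.rpow_natCast, ← mul_pow]; exact pow_le_pow_left₀ h0₂ hl₂ j
  have hypow : (y * t ^ 2) ^ (-A) = y ^ (-A) * t ^ (-(2 * A)) := by
    rw [Real.mul_rpow hy.le (by positivity), ← Real.rpow_natCast t 2, ← Real.rpow_mul ht0.le]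
    ring_nf
  rw [abs_mul, abs_of_pos (inv_pos.mpr ht0)]
  calc t⁻¹ * |KMV2000.logCutoffW i j (A₁ - Real.log t) (A₂ - Real.log t) (y * t ^ 2)|
      ≤ t⁻¹ * (C * (y * t ^ 2) ^ (-A) * (1 + |A₁ - Real.log t|) ^ i * (1 + |A₂ - Real.log t|) ^ j) :=
        mul_le_mul_of_nonneg_left hW (inv_pos.mpr ht0).le
    _ ≤ t⁻¹ * (C * (y * t ^ 2) ^ (-A) * ((1 + |A₁|) ^ i * t ^ (i : ℝ)) * ((1 + |A₂|) ^ j * t ^ (j : ℝ))) := by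
        gcongr
    _ = C * (1 + |A₁|) ^ i * (1 + |A₂|) ^ j * y ^ (-A) *
          (t ^ (-(1 : ℝ)) * t ^ (-(2 * A)) * t ^ (i : ℝ) * t ^ (j : ℝ)) := by
        rw [hypow, Real.rpow_neg_one]; ring
    _ = C * (1 + |A₁|) ^ i * (1 + |A₂|) ^ j * y ^ (-A) * t ^ ((i + j : ℝ) - 1 - 2 * A) := by
        rw [← Real.rpow_add ht0, ← Real.rpow_add ht0, ← Real.rpow_add ht0]; ring_nf

/-- **THE BOX TAIL OF ONE DIAGONAL LINE** (`y > 0`, `2A ≥ i + j + 1`, any `T`):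
`|Σ'_{l ≥ 0} (l+1+T)⁻¹ 𝒲_{ij}(A₁ − log(l+1+T), A₂ − log(l+1+T); y(l+1+T)²)|
   ≤ C_A(i)C_A(j)(1+|A₁|)^i(1+|A₂|)^j · (Σ'_{n ≥ 0} (n+1)⁻²) · y^{−A} · (T+1)^{i+j+1−2A}`
(`t^{i+j−1−2A} ≤ (T+1)^{i+j+1−2A} t⁻²` for `t ≥ T+1`). [cite: KowalskiMichelVanderKam2000, (22) p. 12 — derivation] -/
theorem abs_tsum_lineTail_le (i j : ℕ) {A : ℝ} (hA : (i + j + 1 : ℝ) ≤ 2 * A) (A₁ A₂ : ℝ) {y : ℝ} (hy : 0 < y) (T : ℕ) :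
    |∑' l : ℕ, ((l : ℝ) + 1 + T)⁻¹ *
        KMV2000.logCutoffW i j (A₁ - Real.log ((l : ℝ) + 1 + T)) (A₂ - Real.log ((l : ℝ) + 1 + T))
          (y * ((l : ℝ) + 1 + T) ^ 2)| ≤
      ((∫ x in Ioi (0 : ℝ), x ^ A * (Real.exp (-x) * (2 ^ i * (1 + |Real.log x| ^ i)))) *
        ∫ x in Ioi (0 : ℝ), x ^ A * (Real.exp (-x) * (2 ^ j * (1 + |Real.log x| ^ j)))) *
      (1 + |A₁|) ^ i * (1 + |A₂|) ^ j * (∑' n : ℕ, (((n : ℝ) + 1) ^ 2)⁻¹) *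
      y ^ (-A) * ((T : ℝ) + 1) ^ ((i + j : ℝ) + 1 - 2 * A) := by
  have hA0 : 0 ≤ A := by
    have : (0 : ℝ) ≤ i + j + 1 := by positivity
    linarith
  set C : ℝ := ((∫ x in Ioi (0 : ℝ), x ^ A * (Real.exp (-x) * (2 ^ i * (1 + |Real.log x| ^ i)))) *
    ∫ x in Ioi (0 : ℝ), x ^ A * (Real.exp (-x) * (2 ^ j * (1 + |Real.log x| ^ j)))) *
      (1 + |A₁|) ^ i * (1 + |A₂|) ^ j with hC
  have hC0 : 0 ≤ C := by
    have h1 : 0 ≤ ∫ x in Ioi (0 : ℝ), x ^ A * (Real.exp (-x) * (2 ^ i * (1 + |Real.log x| ^ i))) :=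
      setIntegral_nonneg measurableSet_Ioi fun x hx ↦ by have hx : (0 : ℝ) < x := hx; positivity
    have h2 : 0 ≤ ∫ x in Ioi (0 : ℝ), x ^ A * (Real.exp (-x) * (2 ^ j * (1 + |Real.log x| ^ j))) :=
      setIntegral_nonneg measurableSet_Ioi fun x hx ↦ by have hx : (0 : ℝ) < x := hx; positivity
    rw [hC]; positivity
  set τ : ℕ → ℝ := fun l ↦ (l : ℝ) + 1 + T with hτ
  have hτ1 : ∀ l, (T : ℝ) + 1 ≤ τ l := fun l ↦ by simp only [hτ]; have : (0 : ℝ) ≤ l := l.cast_nonneg; linarith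
  have hT1 : (1 : ℝ) ≤ (T : ℝ) + 1 := by have : (0 : ℝ) ≤ T := T.cast_nonneg; linarith
  have hτpos : ∀ l, 0 < τ l := fun l ↦ lt_of_lt_of_le (by linarith) (hτ1 l)
  -- the summable majorant `C y^{-A} (T+1)^{…} · (l+1)^{-2}`
  have hS : Summable fun n : ℕ ↦ (((n : ℝ) + 1) ^ 2)⁻¹ := by
    have h := (summable_nat_add_iff 1).mpr (Real.summable_one_div_nat_pow.mpr one_lt_two)
    refine h.congr fun n ↦ ?_
    push_cast
    rw [one_div]
  have hptw : ∀ l : ℕ, |(τ l)⁻¹ * KMV2000.logCutoffW i j (A₁ - Real.log (τ l)) (A₂ - Real.log (τ l)) (y * τ l ^ 2)| ≤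
      C * y ^ (-A) * ((T : ℝ) + 1) ^ ((i + j : ℝ) + 1 - 2 * A) * (((l : ℝ) + 1) ^ 2)⁻¹ := by
    intro l
    have h := abs_lineTail_term_le i j hA0 A₁ A₂ hy (hT1.trans (hτ1 l))
    -- `τ^{i+j-1-2A} ≤ (T+1)^{i+j+1-2A} τ^{-2} ≤ (T+1)^{…} (l+1)^{-2}`
    have hsplit : τ l ^ ((i + j : ℝ) - 1 - 2 * A) = τ l ^ ((i + j : ℝ) + 1 - 2 * A) * τ l ^ (-(2 : ℝ)) := by
      rw [← Real.rpow_add (hτpos l)]; ring_nf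
    have hmono : τ l ^ ((i + j : ℝ) + 1 - 2 * A) ≤ ((T : ℝ) + 1) ^ ((i + j : ℝ) + 1 - 2 * A) :=
      Real.rpow_le_rpow_of_nonpos (by linarith) (hτ1 l) (by linarith)
    have hinv : τ l ^ (-(2 : ℝ)) ≤ (((l : ℝ) + 1) ^ 2)⁻¹ := by
      rw [Real.rpow_neg (hτpos l).le, show (2 : ℝ) = ((2 : ℕ) : ℝ) by norm_num, Real.rpow_natCast]
      refine inv_anti₀ (by positivity) (pow_le_pow_left₀ (by positivity) ?_ 2)
      simp only [hτ]; have : (0 : ℝ) ≤ T := T.cast_nonneg; linarith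
    calc |(τ l)⁻¹ * KMV2000.logCutoffW i j (A₁ - Real.log (τ l)) (A₂ - Real.log (τ l)) (y * τ l ^ 2)|
        ≤ C * y ^ (-A) * τ l ^ ((i + j : ℝ) - 1 - 2 * A) := by rw [hC]; exact h
      _ = C * y ^ (-A) * (τ l ^ ((i + j : ℝ) + 1 - 2 * A) * τ l ^ (-(2 : ℝ))) := by rw [hsplit]
      _ ≤ C * y ^ (-A) * (((T : ℝ) + 1) ^ ((i + j : ℝ) + 1 - 2 * A) * (((l : ℝ) + 1) ^ 2)⁻¹) := by
          refine mul_le_mul_of_nonneg_left ?_ (mul_nonneg hC0 (Real.rpow_nonneg hy.le _))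
          exact mul_le_mul hmono hinv (Real.rpow_nonneg (hτpos l).le _) (Real.rpow_nonneg (by linarith) _)
      _ = _ := by ring
  have hmaj : Summable fun l : ℕ ↦ C * y ^ (-A) * ((T : ℝ) + 1) ^ ((i + j : ℝ) + 1 - 2 * A) * (((l : ℝ) + 1) ^ 2)⁻¹ :=
    hS.mul_left _
  have habs : Summable fun l : ℕ ↦
      |(τ l)⁻¹ * KMV2000.logCutoffW i j (A₁ - Real.log (τ l)) (A₂ - Real.log (τ l)) (y * τ l ^ 2)| :=
    Summable.of_nonneg_of_le (fun l ↦ abs_nonneg _) hptw hmaj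
  have hnorm : Summable fun l : ℕ ↦
      ‖(τ l)⁻¹ * KMV2000.logCutoffW i j (A₁ - Real.log (τ l)) (A₂ - Real.log (τ l)) (y * τ l ^ 2)‖ := by
    simpa only [Real.norm_eq_abs] using habs
  calc |∑' l : ℕ, (τ l)⁻¹ * KMV2000.logCutoffW i j (A₁ - Real.log (τ l)) (A₂ - Real.log (τ l)) (y * τ l ^ 2)|
      ≤ ∑' l : ℕ, |(τ l)⁻¹ * KMV2000.logCutoffW i j (A₁ - Real.log (τ l)) (A₂ - Real.log (τ l)) (y * τ l ^ 2)| := by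
        have h := norm_tsum_le_tsum_norm hnorm
        simpa only [Real.norm_eq_abs] using h
    _ ≤ ∑' l : ℕ, C * y ^ (-A) * ((T : ℝ) + 1) ^ ((i + j : ℝ) + 1 - 2 * A) * (((l : ℝ) + 1) ^ 2)⁻¹ :=
        habs.tsum_le_tsum hptw hmaj
    _ = C * y ^ (-A) * ((T : ℝ) + 1) ^ ((i + j : ℝ) + 1 - 2 * A) * ∑' n : ℕ, (((n : ℝ) + 1) ^ 2)⁻¹ := tsum_mul_left
    _ = _ := by rw [hC]; ring

end Summit.Parity.GeneralizedHardyLittlewood.Theorems.MomentsBeyondDiagonal.DiagLines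

end
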